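import Literature.NumberTheory.QuadraticForms.HilbertSymbolNormCompatLowDegree
import Literature.NumberTheory.QuadraticForms.HasseMinkowskiIsometryRat
import Literature.NumberTheory.AdelicBaseChange.InfinitePlaceBaseChange
import HarnessLib

/-!
# The archimedean completions are regular Hilbert fields; the projection formula `(θ, b)_{L_w} = (θ, N b)_{K_v}`
# and the fibre identity at an infinite place `w ∣ v`

Topic `NumberTheory/QuadraticForms`; namespace `Literature.NumberTheory.QuadraticForms`.  THEOREMS ONLY (no definition, no named fact,
no instance, no `sorry`).  Sequel of ★ `HilbertSymbolNormCompatLowDegree` (the projection formula `(θ, b)_K = (θ, N_{K/F} b)_F` for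
`[K : F]` odd or `2` over REGULAR Hilbert fields — bilinear non-degenerate symbols — and its finite-place instance): here the same at the
INFINITE places, whose completions `K_v ≅ ℝ` or `≅ ℂ` are regular Hilbert fields (★ `isRegularHilbertField_real`, Serre IV §2.4; over an
algebraically closed field every non-zero element is a square and every symbol is `1`, O'Meara §63B).

* §1 `IsRegularHilbertField.of_ringEquiv` (transport), `isRegularHilbertField_of_isAlgClosed`, and
  **`isRegularHilbertField_completion_infinitePlace (w : InfinitePlace K)`** (real: transport from `ℝ` along Mathlib's
  `ringEquivRealOfIsReal`; complex: from `ℂ` along `ringEquivComplexOfIsComplex`).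
* §2 at `w ∣ v` infinite (`wv : v.Extension L`, Mathlib's scoped `NumberField.LiesOver` algebra `K_v → L_w`):
  **`hilbertSymbol_completion_eq_hilbertSymbol_norm`** (`[L_w : K_v]` odd or `2` — always, the local degree being `1` or `2`),
  `odd_or_eq_two_finrank_completion_of_finrank_le_three` (from FLT's ★ `finrank_prod_eq_finrank`: `Σ_{w∣v} [L_w : K_v] = [L : K]`), and the
  fibre identity **`prod_hilbertSymbol_completion_eq_hilbertSymbol_prod_norm`**: `∏_{w ∣ v} (θ, b_w)_{L_w} = (θ, ∏_{w ∣ v} N_{L_w/K_v} b_w)_{K_v}`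
  for `[L : K] ≤ 3`.

USE (cell hodgecm-mathlib, G6 R6c `GaloisRepresentations/QuadraticArtinIndicatorNorm`): the norm functoriality of the quadratic Artin
indicator along `K₀/F` of degree `≤ 3` needs the fibre identity at EVERY place, the infinite ones included; with ★
`adeleRelNorm_fst_apply_eq_prod` (`(N X)_v = ∏_{w∣v} N_{L_w/K_v} X_w`) this file is that input.  HC_CM is proved only modulo the printed
citations until rung 0 closes; quadratic-form algebra only.

## References
* [Serre1973] J.-P. Serre, *A Course in Arithmetic* (1973), Ch. III §1.2 Thm 2, Ch. IV §2.4 (real forms).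
* [Omeara1963] O. T. O'Meara, *Introduction to Quadratic Forms* (1963), §63B (63:10; complex and real fields), §63C.
* [CasselsFrohlichANT1967] Cassels–Fröhlich (eds.), *Algebraic Number Theory* (1967), Ch. II §10 (completions at infinite places).
-/

set_option autoImplicit false

noncomputable section

open NumberField
open scoped NumberField.LiesOver

namespace Literature.NumberTheory.QuadraticForms

/-! ## §1 Transport; algebraically closed fields; the archimedean completions -/

section Transport

variable {F F' : Type*} [Field F] [Field F']

/-- Regularity of the Hilbert symbol is transported along a field isomorphism. [cite: Serre1973, Ch. III §1.2 Thm 2] -/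
theorem IsRegularHilbertField.of_ringEquiv (e : F ≃+* F') (h : IsRegularHilbertField F) : IsRegularHilbertField F' where
  two_ne_zero := by
    rw [← map_ofNat e 2]
    exact (map_ne_zero e).2 h.two_ne_zero
  mul_left a b c ha hb hc := by
    have := h.mul_left (e.symm a) (e.symm b) (e.symm c) ((map_ne_zero _).2 ha) ((map_ne_zero _).2 hb) ((map_ne_zero _).2 hc)
    rw [← hilbertSymbol_map_ringEquiv e, ← hilbertSymbol_map_ringEquiv e (e.symm a), ← hilbertSymbol_map_ringEquiv e (e.symm b)] at this
    simpa only [map_mul, RingEquiv.apply_symm_apply] using this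
  exists_eq_neg_one b hb hsq := by
    have hsq' : ¬ IsSquare (e.symm b) := fun ⟨s, hs⟩ => hsq ⟨e s, by rw [← map_mul, ← hs, RingEquiv.apply_symm_apply]⟩
    obtain ⟨a, ha0, ha⟩ := h.exists_eq_neg_one (e.symm b) ((map_ne_zero _).2 hb) hsq'
    refine ⟨e a, (map_ne_zero e).2 ha0, ?_⟩
    rw [← hilbertSymbol_map_ringEquiv e, RingEquiv.apply_symm_apply] at ha
    exact ha

/-- Over an algebraically closed field of characteristic `≠ 2` the Hilbert symbol is (trivially) regular: every symbol of non-zero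
elements is `1` and there are no non-squares. [cite: Omeara1963, §63B (63:10)] -/
theorem isRegularHilbertField_of_isAlgClosed [IsAlgClosed F] (h2 : (2 : F) ≠ 0) : IsRegularHilbertField F where
  two_ne_zero := h2
  mul_left a b c ha hb hc := by
    rw [hilbertSymbol_eq_one_of_isAlgClosed (Or.inl (mul_ne_zero ha hb)), hilbertSymbol_eq_one_of_isAlgClosed (Or.inl ha),
      hilbertSymbol_eq_one_of_isAlgClosed (Or.inl hb), mul_one]
  exists_eq_neg_one b _ hsq := by
    obtain ⟨z, hz⟩ := IsAlgClosed.exists_pow_nat_eq b two_pos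
    exact absurd ⟨z, by rw [← hz]; ring⟩ hsq

end Transport

section Infinite

variable {K : Type*} [Field K]

/-- **The completion of a number field at an infinite place is a regular Hilbert field** (`K_w ≅ ℝ`: Serre's real case; `K_w ≅ ℂ`:
algebraically closed). [cite: Serre1973, Ch. IV §2.4] [cite: Omeara1963, §63B (63:10)] -/
theorem isRegularHilbertField_completion_infinitePlace (w : InfinitePlace K) : IsRegularHilbertField w.Completion := by
  by_cases hw : w.IsReal
  · exact IsRegularHilbertField.of_ringEquiv (InfinitePlace.Completion.ringEquivRealOfIsReal hw).symm isRegularHilbertField_real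
  · have hc : w.IsComplex := InfinitePlace.not_isReal_iff_isComplex.1 hw
    have hC : IsRegularHilbertField ℂ := isRegularHilbertField_of_isAlgClosed two_ne_zero
    exact IsRegularHilbertField.of_ringEquiv (InfinitePlace.Completion.ringEquivComplexOfIsComplex hc).symm hC

end Infinite

/-! ## §2 The projection formula and the fibre identity at an infinite place `w ∣ v` -/

section Extension

variable (K L : Type) [Field K] [NumberField K] [Field L] [NumberField L] [Algebra K L]
variable (v : InfinitePlace K) (wv : v.Extension L)

omit [NumberField K] [NumberField L] in
/-- **The projection formula at an infinite place `w ∣ v`**: `(θ, b)_{L_w} = (θ, N_{L_w/K_v} b)_{K_v}` for `[L_w : K_v]` odd or `2`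
(i.e. always: the archimedean local degree is `1` or `2`). [cite: Serre1973, Ch. III §1.2 Thm 2, Ch. IV §2.4] [cite: Omeara1963, §63B (63:10)] -/
theorem hilbertSymbol_completion_eq_hilbertSymbol_norm
    (hdeg : Odd (Module.finrank v.Completion wv.1.Completion) ∨ Module.finrank v.Completion wv.1.Completion = 2)
    {θ : v.Completion} (hθ : θ ≠ 0) {b : wv.1.Completion} (hb : b ≠ 0) :
    hilbertSymbol wv.1.Completion (algebraMap v.Completion wv.1.Completion θ) b =
      hilbertSymbol v.Completion θ (Algebra.norm v.Completion b) :=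
  (isRegularHilbertField_completion_infinitePlace v).hilbertSymbol_eq_hilbertSymbol_norm
    (isRegularHilbertField_completion_infinitePlace wv.1) hdeg hθ hb

open scoped Classical in
/-- For `[L : K] ≤ 3` every archimedean local degree `[L_w : K_v]` is `1`, `2` or `3`, hence odd or `2` (`Σ_{w∣v} [L_w : K_v] = [L : K]`,
FLT's ★ `finrank_prod_eq_finrank`). [cite: CasselsFrohlichANT1967, Ch. II §10] -/
theorem odd_or_eq_two_finrank_completion_of_finrank_le_three (hKL : Module.finrank K L ≤ 3) :
    Odd (Module.finrank v.Completion wv.1.Completion) ∨ Module.finrank v.Completion wv.1.Completion = 2 := by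
  have hpos : 0 < Module.finrank v.Completion wv.1.Completion := Module.finrank_pos
  have hsum : ∑ w : v.Extension L, Module.finrank v.Completion w.1.Completion = Module.finrank K L := by
    rw [← Module.finrank_pi_fintype v.Completion, InfinitePlace.Completion.finrank_prod_eq_finrank]
  have hle := ((Finset.single_le_sum (f := fun w : v.Extension L => Module.finrank v.Completion w.1.Completion)
    (fun _ _ => Nat.zero_le _) (Finset.mem_univ wv)).trans hsum.le).trans hKL
  interval_cases (Module.finrank v.Completion wv.1.Completion) <;> decide

open scoped Classical in
/-- **The fibre identity at an infinite place**: `∏_{w ∣ v} (θ, b_w)_{L_w} = (θ, ∏_{w ∣ v} N_{L_w/K_v} b_w)_{K_v}` for `[L : K] ≤ 3`.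
[cite: Serre1973, Ch. III §1.2 Thm 2, Ch. IV §2.4] [cite: Omeara1963, §63B (63:10)] -/
theorem prod_hilbertSymbol_completion_eq_hilbertSymbol_prod_norm (hKL : Module.finrank K L ≤ 3) {θ : v.Completion} (hθ : θ ≠ 0)
    (b : ∀ w : v.Extension L, w.1.Completion) (hb : ∀ w, b w ≠ 0) :
    ∏ w : v.Extension L, hilbertSymbol w.1.Completion (algebraMap v.Completion w.1.Completion θ) (b w) =
      hilbertSymbol v.Completion θ (∏ w : v.Extension L, Algebra.norm v.Completion (b w)) := by
  have key : ∀ s : Finset (v.Extension L),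
      ∏ w ∈ s, hilbertSymbol w.1.Completion (algebraMap v.Completion w.1.Completion θ) (b w) =
        hilbertSymbol v.Completion θ (∏ w ∈ s, Algebra.norm v.Completion (b w)) := by
    intro s
    induction s using Finset.induction_on with
    | empty => simp [hilbertSymbol_one_right]
    | insert w s hw ih =>
      rw [Finset.prod_insert hw, Finset.prod_insert hw, ih,
        hilbertSymbol_completion_eq_hilbertSymbol_norm K L v w (odd_or_eq_two_finrank_completion_of_finrank_le_three K L v w hKL) hθ (hb w),
        (isRegularHilbertField_completion_infinitePlace v).mul_right hθ (Algebra.norm_ne_zero_iff.2 (hb w))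
          (Finset.prod_ne_zero_iff.2 fun w' _ => Algebra.norm_ne_zero_iff.2 (hb w'))]
  exact key Finset.univ

end Extension

end Literature.NumberTheory.QuadraticForms

end
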